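import Mathlib
import Literature.Analysis.FluidPDE.VectorCalculus

/-!
# `SkeletonEquilibrium` (stmt-NavierStokesRegularity-15400): half-turn-symmetric strands are never single-filament equilibria

Negative-side structural helper for the (held) support item `FilamentSkeletonRss.SkeletonEquilibrium`
(`--supports stmt-NavierStokesRegularity-15400`), generalising the helix/solenoid exclusion
(`Theorems/FilamentSkeletonRssSkeletonEquilibriumHelixExclusion.lean`) from the 4-parameter helix family to a
DISCRETE-SYMMETRY CLASS. Let `x₀ = Ξ(0) = (a, 0, z₀)` be a point of a differentiable filament `Ξ` at distance
`a ≠ 0` from the rotation axis, and let `ρ` be the half-turn (rotation by `π`) about the RADIAL line through `x₀`,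
`ρ(x, y, z) = (x, −y, 2z₀ − z)`. Suppose the strand is `ρ`-symmetric with parameter reversal,
`Ξ(−σ) = ρ(Ξ(σ))` — in coordinates `Ξ(−σ)₀ = Ξ(σ)₀`, `Ξ(−σ)₁ = −Ξ(σ)₁`, `Ξ(−σ)₂ = 2z₀ − Ξ(σ)₂` (the
hypothesis `hsym`; it forces `Ξ(0) = (a, 0, z₀)`). Examples: every axial helix / solenoid / horizontal circle /
off-axis vertical line (phase normalised), every hairpin or parabola `x = a + f(z − z₀)`, `y = g(z − z₀)` with `f`
even and `g` odd, every strand obtained from a half-strand by the half-turn.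

* `deriv_apply_neg_of_affine_symmetry` — transport of an affine coordinate symmetry `Ξ(−σ)ᵢ = s·Ξ(σ)ᵢ + t` to
  the velocity: `Ξ′(−σ)ᵢ = −s·Ξ′(σ)ᵢ` (chain rule + uniqueness of derivatives).
* `integral_apply_zero_eq_zero_of_halfTurn` — the regularised Biot–Savart self-induction of the crux,
  `∫ ((‖Ξ 0 − Ξ σ‖² + 1)^{3/2})⁻¹ • Ξ′σ × (Ξ 0 − Ξ σ) dσ`, has ZERO component along the symmetry axis `e₀` at
  `x₀`: `ρ` is a rotation fixing `x₀` and `e₀`, mapping the oriented strand to itself with orientation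
  reversed, so the `e₀`-component of the integrand is odd in `σ` (`‖Ξ 0 − Ξ(−σ)‖ = ‖Ξ 0 − Ξ σ‖`,
  `(Ξ′(−σ) × (Ξ 0 − Ξ(−σ)))₀ = −(Ξ′σ × (Ξ 0 − Ξ σ))₀`). No integrability hypothesis (Bochner convention).
* `halfTurn_not_tangent` — hence the relative-equilibrium identity `c • self + ½ Ξ 0 − α e₃ × Ξ 0 = w Ξ′ 0`
  FAILS for every `c, α, w`: its `e₀`-component reads `a/2 = 0` (`e₃ × x₀ = a e₂ ⊥ e₀`, and `Ξ′(0) ⊥ e₀`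
  by the symmetry).
* `no_single_halfTurn_equilibrium` — the `N = 1` tangency clause of `SkeletonEquilibrium` VERBATIM has no
  solution in the class; `radial_balance_of_halfTurn_strand` — for general `N`, the partner filaments must
  induce at `x₀` an inward radial velocity of size exactly `a/2` (self term radial-free).

WLOG normalisations: the marked point sits at parameter `0` (shift `σ ↦ σ − τ₀`) and in the half-plane
`{y = 0}` (rotate about `e₃`); both operations leave the clause invariant. Def-free (the symmetry is the
coordinate hypothesis `hsym`); Mathlib + `Literature.Analysis.FluidPDE.VectorCalculus` (`cross`) only.
-/

-- `NavierStokesRegularity.NavierStokesRegularity` is the summit/problem path (D-0017), flagged by dupNamespace.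
set_option linter.dupNamespace false

namespace Summit.NavierStokesRegularity.NavierStokesRegularity.Theorems.SkeletonEquilibrium.HalfTurnExclusion

open Literature.Analysis.FluidPDE MeasureTheory Real Filter
open scoped RealInnerProductSpace InnerProductSpace BigOperators Topology

/-- Radial (`0`-th) component of the cross product `v × w`. [folklore] -/
private theorem cross_apply_zero (v w : EuclideanSpace ℝ (Fin 3)) :
    cross v w 0 = v 1 * w 2 - v 2 * w 1 := by
  simp [cross, cross_apply]

/-- `⟪e₀, v⟫ = v 0`. [folklore] -/
private theorem inner_single_zero_left (v : EuclideanSpace ℝ (Fin 3)) :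
    ⟪EuclideanSpace.single (0 : Fin 3) (1 : ℝ), v⟫ = v 0 := by
  rw [EuclideanSpace.inner_single_left]; simp

/-- Components of `e₂ = EuclideanSpace.single 2 1`: `e₂ 1 = 0`. [folklore] -/
private theorem single_two_apply_one : (EuclideanSpace.single (2 : Fin 3) (1 : ℝ)) 1 = 0 := by simp

/-- Components of `e₂ = EuclideanSpace.single 2 1`: `e₂ 2 = 1`. [folklore] -/
private theorem single_two_apply_two : (EuclideanSpace.single (2 : Fin 3) (1 : ℝ)) 2 = 1 := by simp

/-- The integral of an odd real function over `ℝ` vanishes (no integrability needed). [folklore] -/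
private theorem integral_eq_zero_of_odd (h : ℝ → ℝ) (hodd : ∀ σ, h (-σ) = -h σ) :
    ∫ σ, h σ = 0 := by
  have h1 : ∫ σ, h (-σ) = ∫ σ, h σ := integral_neg_eq_self h volume
  simp_rw [hodd, integral_neg] at h1
  linarith

/-- The coordinate functions of a differentiable curve in `ℝ³` are differentiable with derivative the
coordinate of the velocity. [folklore] -/
private theorem hasDerivAt_apply {Ξ : ℝ → EuclideanSpace ℝ (Fin 3)} (hd : Differentiable ℝ Ξ)
    (i : Fin 3) (σ : ℝ) : HasDerivAt (fun σ' => Ξ σ' i) (deriv Ξ σ i) σ := by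
  have h := ((EuclideanSpace.proj i : EuclideanSpace ℝ (Fin 3) →L[ℝ] ℝ).hasFDerivAt).comp_hasDerivAt σ
    (hd σ).hasDerivAt
  exact h

/-- **Transport of an affine coordinate symmetry to the velocity.** If a differentiable curve satisfies
`Ξ(−σ)ᵢ = s·Ξ(σ)ᵢ + t` for all `σ` (one coordinate `i`, constants `s, t`), then `Ξ′(−σ)ᵢ = −s·Ξ′(σ)ᵢ`
(chain rule for `σ ↦ −σ` and uniqueness of the derivative). [folklore] -/
theorem deriv_apply_neg_of_affine_symmetry {Ξ : ℝ → EuclideanSpace ℝ (Fin 3)}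
    (hd : Differentiable ℝ Ξ) (i : Fin 3) (s t : ℝ) (h : ∀ σ, Ξ (-σ) i = s * Ξ σ i + t) (σ : ℝ) :
    deriv Ξ (-σ) i = -(s * deriv Ξ σ i) := by
  have h1 : HasDerivAt (fun σ' => Ξ (-σ') i) (deriv Ξ (-σ) i * (-1)) σ := by
    have hc := (hasDerivAt_apply hd i (-σ)).comp σ (hasDerivAt_neg σ)
    simpa [Function.comp_def] using hc
  have h2 : HasDerivAt (fun σ' => Ξ (-σ') i) (s * deriv Ξ σ i) σ := by
    have hb := ((hasDerivAt_apply hd i σ).const_mul s).add_const t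
    refine hb.congr_of_eventuallyEq (Eventually.of_forall fun σ' => ?_)
    simp [h σ']
  have hu := h1.unique h2
  linarith

section HalfTurn

variable {z₀ : ℝ} {Ξ : ℝ → EuclideanSpace ℝ (Fin 3)} (hd : Differentiable ℝ Ξ)
  (hsym : ∀ σ, Ξ (-σ) 0 = Ξ σ 0 ∧ Ξ (-σ) 1 = -(Ξ σ 1) ∧ Ξ (-σ) 2 = 2 * z₀ - Ξ σ 2)
include hsym

/-- The marked point lies on the symmetry axis: `Ξ(0) = (Ξ(0)₀, 0, z₀)`. [folklore] -/
theorem apply_zero_of_halfTurn : Ξ 0 1 = 0 ∧ Ξ 0 2 = z₀ := by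
  obtain ⟨_, h1, h2⟩ := hsym 0
  rw [neg_zero] at h1 h2
  constructor <;> linarith

/-- The regularising distance is even in the parameter: `‖Ξ 0 − Ξ(−σ)‖ = ‖Ξ 0 − Ξ σ‖` (`ρ` is an isometry
fixing `Ξ 0`). [folklore] -/
private theorem norm_chord_neg_of_halfTurn (σ : ℝ) : ‖Ξ 0 - Ξ (-σ)‖ = ‖Ξ 0 - Ξ σ‖ := by
  obtain ⟨h01, h02⟩ := apply_zero_of_halfTurn hsym
  obtain ⟨hn0, hn1, hn2⟩ := hsym σ
  rw [EuclideanSpace.norm_eq, EuclideanSpace.norm_eq]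
  congr 1
  simp only [Fin.sum_univ_three, PiLp.sub_apply, h01, h02, hn0, hn1, hn2, Real.norm_eq_abs, sq_abs]
  ring

include hd

/-- Velocity symmetry: `Ξ′(−σ) = (−Ξ′(σ)₀, Ξ′(σ)₁, Ξ′(σ)₂)`. [folklore] -/
theorem deriv_apply_neg_of_halfTurn (σ : ℝ) :
    deriv Ξ (-σ) 0 = -(deriv Ξ σ 0) ∧ deriv Ξ (-σ) 1 = deriv Ξ σ 1 ∧ deriv Ξ (-σ) 2 = deriv Ξ σ 2 := by
  refine ⟨?_, ?_, ?_⟩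
  · have h := deriv_apply_neg_of_affine_symmetry hd 0 1 0 (fun σ' => by rw [(hsym σ').1]; ring) σ
    linarith
  · have h := deriv_apply_neg_of_affine_symmetry hd 1 (-1) 0 (fun σ' => by rw [(hsym σ').2.1]; ring) σ
    linarith
  · have h := deriv_apply_neg_of_affine_symmetry hd 2 (-1) (2 * z₀)
      (fun σ' => by rw [(hsym σ').2.2]; ring) σ
    linarith

/-- In particular the tangent at the marked point is orthogonal to the symmetry axis: `Ξ′(0)₀ = 0`. [folklore] -/
theorem deriv_zero_apply_zero_of_halfTurn : deriv Ξ 0 0 = 0 := by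
  have h := (deriv_apply_neg_of_halfTurn hd hsym 0).1
  rw [neg_zero] at h
  linarith

/-- The `e₀`-component of the crux's self-induction integrand is ODD in the parameter. [folklore] -/
private theorem inner_single_zero_integrand_odd_of_halfTurn (σ : ℝ) :
    ⟪EuclideanSpace.single (0 : Fin 3) (1 : ℝ),
      ((‖Ξ 0 - Ξ (-σ)‖ ^ 2 + 1) ^ (3 / 2 : ℝ))⁻¹ • cross (deriv Ξ (-σ)) (Ξ 0 - Ξ (-σ))⟫ =
      -⟪EuclideanSpace.single (0 : Fin 3) (1 : ℝ),
        ((‖Ξ 0 - Ξ σ‖ ^ 2 + 1) ^ (3 / 2 : ℝ))⁻¹ • cross (deriv Ξ σ) (Ξ 0 - Ξ σ)⟫ := by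
  obtain ⟨h01, h02⟩ := apply_zero_of_halfTurn hsym
  obtain ⟨_, hn1, hn2⟩ := hsym σ
  obtain ⟨_, hd1, hd2⟩ := deriv_apply_neg_of_halfTurn hd hsym σ
  rw [norm_chord_neg_of_halfTurn hsym σ, real_inner_smul_right, real_inner_smul_right,
    inner_single_zero_left, inner_single_zero_left, cross_apply_zero, cross_apply_zero]
  simp only [PiLp.sub_apply, h01, h02, hn1, hn2, hd1, hd2]
  ring

/-- **Half-turn symmetry kills the axial component of the self-induction.** For a differentiable strand with
`Ξ(−σ) = ρ(Ξ(σ))`, `ρ` the half-turn about the radial line through `Ξ(0) = (a, 0, z₀)`, the regularised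
Biot–Savart self-induction of the crux at `Ξ 0` is orthogonal to `e₀`; if the integrand is not integrable the
Bochner integral is `0` and the claim holds trivially. [folklore] -/
theorem integral_apply_zero_eq_zero_of_halfTurn :
    (∫ σ : ℝ, ((‖Ξ 0 - Ξ σ‖ ^ 2 + 1) ^ (3 / 2 : ℝ))⁻¹ • cross (deriv Ξ σ) (Ξ 0 - Ξ σ)) 0 = 0 := by
  rw [← inner_single_zero_left]
  by_cases hI : Integrable (fun σ : ℝ => ((‖Ξ 0 - Ξ σ‖ ^ 2 + 1) ^ (3 / 2 : ℝ))⁻¹ •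
      cross (deriv Ξ σ) (Ξ 0 - Ξ σ))
  · rw [← integral_inner hI]
    exact integral_eq_zero_of_odd _ (inner_single_zero_integrand_odd_of_halfTurn hd hsym)
  · rw [integral_undef hI, inner_zero_right]

/-- **Half-turn-symmetric strands are never tangent to the Leray–rotating skeleton field at the marked point.**
With `a = Ξ(0)₀ ≠ 0` and ANY coefficient `c`, angular speed `α` and slip value `w`, the relative-equilibrium
identity of `SkeletonEquilibrium` at `Ξ 0`,
`c • ∫ ((‖Ξ 0 − Ξ σ‖²+1)^{3/2})⁻¹ • Ξ′σ × (Ξ 0 − Ξ σ) dσ + ½ Ξ 0 − α e₃ × Ξ 0 = w Ξ′ 0`, is false: its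
`e₀`-component reads `a/2 = 0`. [folklore] -/
theorem halfTurn_not_tangent (ha : Ξ 0 0 ≠ 0) (c α w : ℝ) :
    c • (∫ σ : ℝ, ((‖Ξ 0 - Ξ σ‖ ^ 2 + 1) ^ (3 / 2 : ℝ))⁻¹ • cross (deriv Ξ σ) (Ξ 0 - Ξ σ)) +
      (1 / 2 : ℝ) • Ξ 0 - α • cross (EuclideanSpace.single (2 : Fin 3) (1 : ℝ)) (Ξ 0) ≠
      w • deriv Ξ 0 := by
  intro h
  have key := congrArg (fun v => ⟪EuclideanSpace.single (0 : Fin 3) (1 : ℝ), v⟫) h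
  obtain ⟨h01, _⟩ := apply_zero_of_halfTurn hsym
  have hd0 := deriv_zero_apply_zero_of_halfTurn hd hsym
  simp only [inner_sub_right, inner_add_right, real_inner_smul_right, inner_single_zero_left,
    integral_apply_zero_eq_zero_of_halfTurn hd hsym, mul_zero, zero_add,
    cross_apply_zero, single_two_apply_one, single_two_apply_two, h01, hd0, zero_mul, sub_zero] at key
  apply ha
  linarith

end HalfTurn

/-- **No single-filament relative equilibrium is half-turn symmetric about a radial line through an off-axis
point.** The `N = 1` tangency clause of `FilamentSkeletonRss.SkeletonEquilibrium` VERBATIM (sum over `Fin 1`,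
coefficient `Γγ₀/4π`, frame rotation `α e₃ × ·`) has no differentiable solution filament with
`Ξ(−σ) = ρ(Ξ(σ))` (`ρ` the half-turn about the radial line through `Ξ(0)`, `Ξ(0)₀ ≠ 0`), for any `Γ, γ, α, w`:
evaluate at `(j, τ) = (0, 0)` and apply `halfTurn_not_tangent`. [folklore] -/
theorem no_single_halfTurn_equilibrium (z₀ : ℝ) (Ξ : Fin 1 → ℝ → EuclideanSpace ℝ (Fin 3))
    (hd : Differentiable ℝ (Ξ 0))
    (hsym : ∀ σ, Ξ 0 (-σ) 0 = Ξ 0 σ 0 ∧ Ξ 0 (-σ) 1 = -(Ξ 0 σ 1) ∧ Ξ 0 (-σ) 2 = 2 * z₀ - Ξ 0 σ 2)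
    (ha : Ξ 0 0 0 ≠ 0) (γ : Fin 1 → ℝ) (Γ α : ℝ) (w : Fin 1 → ℝ → ℝ) :
    ¬ (∀ (j : Fin 1) (τ : ℝ), (∑ k : Fin 1, (Γ * γ k / (4 * Real.pi)) • ∫ σ : ℝ,
        ((‖Ξ j τ - Ξ k σ‖ ^ 2 + 1) ^ (3 / 2 : ℝ))⁻¹ • cross (deriv (Ξ k) σ) (Ξ j τ - Ξ k σ)) +
        (1 / 2 : ℝ) • Ξ j τ - α • cross (EuclideanSpace.single (2 : Fin 3) (1 : ℝ)) (Ξ j τ) =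
        w j τ • deriv (Ξ j) τ) := by
  intro h
  have h0 := h 0 0
  rw [Fin.sum_univ_one] at h0
  exact halfTurn_not_tangent hd hsym ha (Γ * γ 0 / (4 * Real.pi)) α (w 0 0) h0

/-- **Radial balance law for a half-turn-symmetric strand (general `N`).** If filament `j` of a configuration
is differentiable and half-turn symmetric about the radial line through `Ξ_j(0) = (a, 0, z₀)`, and the
tangency clause of `SkeletonEquilibrium` holds at `(j, τ = 0)`, then (i) the self term has no radial
component there and (ii) the radial components of all induction terms sum to `−a/2`: the partner filaments
must push the strand INWARD at speed exactly `a/2`. [folklore] -/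
theorem radial_balance_of_halfTurn_strand {N : ℕ} (z₀ : ℝ) (Ξ : Fin N → ℝ → EuclideanSpace ℝ (Fin 3))
    (j : Fin N) (hd : Differentiable ℝ (Ξ j))
    (hsym : ∀ σ, Ξ j (-σ) 0 = Ξ j σ 0 ∧ Ξ j (-σ) 1 = -(Ξ j σ 1) ∧ Ξ j (-σ) 2 = 2 * z₀ - Ξ j σ 2)
    (γ : Fin N → ℝ) (Γ α w₀ : ℝ)
    (heq : (∑ k : Fin N, (Γ * γ k / (4 * Real.pi)) • ∫ σ : ℝ,
        ((‖Ξ j 0 - Ξ k σ‖ ^ 2 + 1) ^ (3 / 2 : ℝ))⁻¹ • cross (deriv (Ξ k) σ) (Ξ j 0 - Ξ k σ)) +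
        (1 / 2 : ℝ) • Ξ j 0 - α • cross (EuclideanSpace.single (2 : Fin 3) (1 : ℝ)) (Ξ j 0) =
        w₀ • deriv (Ξ j) 0) :
    (∫ σ : ℝ, ((‖Ξ j 0 - Ξ j σ‖ ^ 2 + 1) ^ (3 / 2 : ℝ))⁻¹ • cross (deriv (Ξ j) σ) (Ξ j 0 - Ξ j σ)) 0
        = 0 ∧
    (∑ k : Fin N, ⟪EuclideanSpace.single (0 : Fin 3) (1 : ℝ), (Γ * γ k / (4 * Real.pi)) • ∫ σ : ℝ,
        ((‖Ξ j 0 - Ξ k σ‖ ^ 2 + 1) ^ (3 / 2 : ℝ))⁻¹ • cross (deriv (Ξ k) σ) (Ξ j 0 - Ξ k σ)⟫) =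
      -(Ξ j 0 0 / 2) := by
  refine ⟨integral_apply_zero_eq_zero_of_halfTurn hd hsym, ?_⟩
  have key := congrArg (fun v => ⟪EuclideanSpace.single (0 : Fin 3) (1 : ℝ), v⟫) heq
  obtain ⟨h01, _⟩ := apply_zero_of_halfTurn hsym
  have hd0 := deriv_zero_apply_zero_of_halfTurn hd hsym
  simp only [inner_sub_right, inner_add_right, inner_sum, real_inner_smul_right,
    inner_single_zero_left, cross_apply_zero, single_two_apply_one, single_two_apply_two, h01, hd0,
    zero_mul, mul_zero, sub_zero] at key
  simp only [real_inner_smul_right, inner_single_zero_left]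
  linarith

/-- **The helix is the basic example.** The axial helix `(a cos ωσ, a sin ωσ, z₀ + pσ)` satisfies the half-turn
symmetry hypothesis `hsym` (and is differentiable), so the present file contains the helix exclusion of
`…HelixExclusion` as a special case. [folklore] -/
theorem helix_halfTurn_symmetric (a ω p z₀ : ℝ) (Ξ : ℝ → EuclideanSpace ℝ (Fin 3))
    (hΞ : Ξ = fun σ => (a * Real.cos (ω * σ)) • EuclideanSpace.single (0 : Fin 3) (1 : ℝ) +
      (a * Real.sin (ω * σ)) • EuclideanSpace.single (1 : Fin 3) (1 : ℝ) +
      (z₀ + p * σ) • EuclideanSpace.single (2 : Fin 3) (1 : ℝ)) :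
    Differentiable ℝ Ξ ∧
      ∀ σ, Ξ (-σ) 0 = Ξ σ 0 ∧ Ξ (-σ) 1 = -(Ξ σ 1) ∧ Ξ (-σ) 2 = 2 * z₀ - Ξ σ 2 := by
  subst hΞ
  refine ⟨by fun_prop, fun σ => ⟨?_, ?_, ?_⟩⟩
  · simp [mul_neg, Real.cos_neg]
  · simp [mul_neg, Real.sin_neg]
  · simp [mul_neg]; ring

end Summit.NavierStokesRegularity.NavierStokesRegularity.Theorems.SkeletonEquilibrium.HalfTurnExclusion
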